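import Literature.AlgebraicGeometry.Resolution.AlterationsResolution
import Literature.AlgebraicGeometry.Resolution.RegularLocalRingsNormal
import Literature.AlgebraicGeometry.Resolution.ResolutionOfCurves
import Mathlib.AlgebraicGeometry.Morphisms.Finite
import Mathlib.AlgebraicGeometry.Morphisms.UniversallyInjective
import HarnessLib

/-!
# `Pialt` (crux stmt-ResolutionOfSingularities-0555), line `SketchIdeator2` / Card A: known cases of `stub_tameResolution`

Helper file of the lead's skeleton `radicially-regular-endgame`
(`--supports stmt-ResolutionOfSingularities-0555`; it does not close the item).

Call an integral scheme `Z` **radicially regular (RR)** if an integral regular scheme `W` maps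
onto it by a finite, universally injective, surjective morphism `W → Z`, and **locally RR
(LRR)** if every point of `Z` has an RR open neighbourhood. A **tame resolution** of an integral
scheme `X` is a proper birational `π : Z → X` with `Z` integral, normal (all stalks integrally
closed) and LRR. The stub `stub_tameResolution` (`TameResolution_p`) of the skeleton asks for a
tame resolution of every integral separated scheme of finite type over a perfect field of
characteristic `p`; it is a PARTIAL RESOLUTION statement, open from dimension `4` on (barrier
`DimensionFourFrontier`). This file records, sorry-free, the cases in which it is known, all by
the same remark:

**A resolution of singularities is a tame resolution** (`isTame_of_isResolution`). If
`π : Z → X` is proper birational with `Z` regular and `X` integral, then `Z` is reduced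
(a regular local ring is a domain; `Scheme.IsRegular.isReduced`, Matsumura Thm. 14.3), hence
integral (`IsBirational.isIntegral`: the dense open `π⁻¹(U) ≅ U` is irreducible); its stalks are
regular local rings, hence integrally closed (Matsumura Thm. 19.4,
`isIntegrallyClosed_of_isRegularLocalRing`); and every point is LRR with the neighbourhood
`U := ⊤`, dominated by `Z` itself through the isomorphism `(Scheme.topIso Z).inv : Z ⟶ ↑⊤` — an
isomorphism is finite, universally injective (a monomorphism) and surjective.

Consequences (the conclusion is always the one of `stub_tameResolution`, verbatim):

* `exists_tameResolution_of_hasResolution` — `Scheme.HasResolution X` suffices;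
* `tameResolution_of_isRegular` — `X` regular (unconditional: `Z := X`);
* `tameResolution_of_dim_le_one` — `dim X ≤ 1` (unconditional: reduced curves over a field are
  resolved by normalising, `hasResolution_of_dim_le_one`);
* `tameResolution_of_dim_le_three` — `dim X ≤ 3`, conditional on the named fact
  `CossartPiltant2019` (Cossart–Piltant 2019, Thm. 1.1), over ANY field;
* `tameResolution_of_resolutionInChar`, `stubTameResolution_of_resolutionOfSingularities` —
  resolution of singularities in characteristic `p` (resp. the summit statement
  `ResolutionOfSingularities`) implies the stub in its registered form: the stub does not
  strengthen the summit;
* `tameResolution_of_normal_of_locallyRadiciallyRegular` — a normal LRR integral scheme is its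
  own tame resolution (`π := 𝟙`): the LRR class is terminal for the partial-resolution problem.

What is NOT here (and is the open content of the stub): improving a normal integral variety of
dimension `≥ 4` at a point that is not LRR (e.g. an `A₁` point in odd characteristic, whose
punctured strict henselisation has étale `π₁ = ℤ/2`, an invariant of finite universal
homeomorphisms that vanishes for regular local rings by Zariski–Nagata purity) by blow-ups with
a terminating invariant.
-/

set_option linter.dupNamespace false -- mandated namespace of this single-conjunct summit

noncomputable section

open CategoryTheory AlgebraicGeometry TopologicalSpace
open Literature.AlgebraicGeometry.Resolution

namespace Summit.ResolutionOfSingularities.ResolutionOfSingularities.Theorems.Pialt.RadiciallyRegular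

/-! ## A resolution is a tame resolution -/

/-- **A resolution of singularities is a tame resolution.** If `X` is integral and `π : Z → X`
is a resolution (proper, birational, `Z` regular), then `π` is proper and birational, `Z` is
integral (regular ⇒ reduced, and birational onto the integral `X`) and normal (regular local
rings are integrally closed, Matsumura Thm. 19.4), and every point of `Z` is locally radicially
regular: the open neighbourhood `⊤` is dominated by the integral regular `Z` itself through the
isomorphism `Z ⟶ ↑⊤`, which is finite, universally injective and surjective. [folklore] -/
theorem isTame_of_isResolution {Z X : Scheme.{0}} [IsIntegral X] {π : Z ⟶ X}
    (hπ : IsResolution π) :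
    IsProper π ∧ IsBirational π ∧ IsIntegral Z ∧
      (∀ z : Z, IsIntegrallyClosed (Z.presheaf.stalk z)) ∧
      ∀ z : Z, ∃ U : Z.Opens, z ∈ U ∧ ∃ (W : Scheme.{0}) (h : W ⟶ (U : Scheme.{0})),
        IsIntegral W ∧ Scheme.IsRegular W ∧ IsFinite h ∧ UniversallyInjective h ∧
          Function.Surjective h.base := by
  haveI : IsReduced Z := hπ.isRegular.isReduced
  haveI : IsIntegral Z := hπ.isBirational.isIntegral
  refine ⟨hπ.isProper, hπ.isBirational, inferInstance,
    fun z => haveI := hπ.isRegular z; isIntegrallyClosed_of_isRegularLocalRing _, fun z => ?_⟩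
  exact ⟨⊤, trivial, Z, (Scheme.topIso Z).inv, inferInstance, hπ.isRegular, inferInstance,
    inferInstance, (Scheme.homeoOfIso (Scheme.topIso Z).symm).surjective⟩

/-- If the integral `X` admits a resolution of singularities, then it admits a tame resolution
(the resolution itself, `isTame_of_isResolution`). [folklore] -/
theorem exists_tameResolution_of_hasResolution (X : Scheme.{0}) [IsIntegral X]
    (hres : Scheme.HasResolution X) :
    ∃ (Z : Scheme.{0}) (π : Z ⟶ X), IsProper π ∧ IsBirational π ∧ IsIntegral Z ∧
      (∀ z : Z, IsIntegrallyClosed (Z.presheaf.stalk z)) ∧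
      ∀ z : Z, ∃ U : Z.Opens, z ∈ U ∧ ∃ (W : Scheme.{0}) (h : W ⟶ (U : Scheme.{0})),
        IsIntegral W ∧ Scheme.IsRegular W ∧ IsFinite h ∧ UniversallyInjective h ∧
          Function.Surjective h.base := by
  obtain ⟨Z, π, hπ⟩ := hres
  exact ⟨Z, π, isTame_of_isResolution hπ⟩

/-! ## Unconditional cases -/

/-- A regular integral scheme is its own tame resolution (`π := 𝟙 X` is a resolution,
`Scheme.IsRegular.hasResolution`). [folklore] -/
theorem tameResolution_of_isRegular (X : Scheme.{0}) [IsIntegral X] (hreg : Scheme.IsRegular X) :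
    ∃ (Z : Scheme.{0}) (π : Z ⟶ X), IsProper π ∧ IsBirational π ∧ IsIntegral Z ∧
      (∀ z : Z, IsIntegrallyClosed (Z.presheaf.stalk z)) ∧
      ∀ z : Z, ∃ U : Z.Opens, z ∈ U ∧ ∃ (W : Scheme.{0}) (h : W ⟶ (U : Scheme.{0})),
        IsIntegral W ∧ Scheme.IsRegular W ∧ IsFinite h ∧ UniversallyInjective h ∧
          Function.Surjective h.base :=
  exists_tameResolution_of_hasResolution X hreg.hasResolution

/-- **Curves, unconditionally.** An integral scheme of finite type over a field `k` of
dimension `≤ 1` has a tame resolution: its normalisation is a (finite) resolution of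
singularities (`hasResolution_of_dim_le_one`: normal Noetherian domains of dimension one are
regular, and the normalisation of a variety is finite by E. Noether). Separatedness over `k` is
not needed. [folklore] -/
theorem tameResolution_of_dim_le_one (k : Type) [Field k] (X : Scheme.{0})
    (f : X ⟶ Spec (.of k)) [LocallyOfFiniteType f] [QuasiCompact f] [IsIntegral X]
    (hdim : topologicalKrullDim X ≤ 1) :
    ∃ (Z : Scheme.{0}) (π : Z ⟶ X), IsProper π ∧ IsBirational π ∧ IsIntegral Z ∧
      (∀ z : Z, IsIntegrallyClosed (Z.presheaf.stalk z)) ∧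
      ∀ z : Z, ∃ U : Z.Opens, z ∈ U ∧ ∃ (W : Scheme.{0}) (h : W ⟶ (U : Scheme.{0})),
        IsIntegral W ∧ Scheme.IsRegular W ∧ IsFinite h ∧ UniversallyInjective h ∧
          Function.Surjective h.base :=
  exists_tameResolution_of_hasResolution X (hasResolution_of_dim_le_one X f hdim)

/-! ## Dimension at most three (Cossart–Piltant 2019) -/

/-- **Dimension `≤ 3`, conditional on `CossartPiltant2019`.** Under the named fact
`CossartPiltant2019` (Cossart–Piltant 2019, Thm. 1.1: reduced separated quasi-excellent schemes
of dimension at most three admit a resolution of singularities; here for schemes of finite type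
over a field), every integral separated scheme `X` of finite type over ANY field `k` with
`dim X ≤ 3` has a tame resolution — the Cossart–Piltant resolution itself
(`isTame_of_isResolution`). This is the known range of `stub_tameResolution`; the first open
instance is a normal fourfold. [cite: CossartPiltant2019, Thm. 1.1] -/
theorem tameResolution_of_dim_le_three (hCP : CossartPiltant2019.{0}) (k : Type) [Field k]
    (X : Scheme.{0}) (f : X ⟶ Spec (.of k)) [IsSeparated f] [LocallyOfFiniteType f]
    [QuasiCompact f] [IsIntegral X] (hdim : topologicalKrullDim X ≤ 3) :
    ∃ (Z : Scheme.{0}) (π : Z ⟶ X), IsProper π ∧ IsBirational π ∧ IsIntegral Z ∧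
      (∀ z : Z, IsIntegrallyClosed (Z.presheaf.stalk z)) ∧
      ∀ z : Z, ∃ U : Z.Opens, z ∈ U ∧ ∃ (W : Scheme.{0}) (h : W ⟶ (U : Scheme.{0})),
        IsIntegral W ∧ Scheme.IsRegular W ∧ IsFinite h ∧ UniversallyInjective h ∧
          Function.Surjective h.base :=
  exists_tameResolution_of_hasResolution X (hCP k X f ‹_› ‹_› ‹_› inferInstance hdim)

/-- The same in the exact shape of the stub (prime `p`, perfect ground field of characteristic
`p` — hypotheses that the Cossart–Piltant case does not use), with the extra hypothesis
`dim X ≤ 3`. [cite: CossartPiltant2019, Thm. 1.1] -/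
theorem stubTameResolution_of_dim_le_three (hCP : CossartPiltant2019.{0}) (p : ℕ) (_hp : p.Prime)
    (k : Type) [Field k] [CharP k p] [PerfectField k] (X : Scheme.{0}) (f : X ⟶ Spec (.of k))
    [IsSeparated f] [LocallyOfFiniteType f] [QuasiCompact f] [IsIntegral X]
    (hdim : topologicalKrullDim X ≤ 3) :
    ∃ (Z : Scheme.{0}) (π : Z ⟶ X), IsProper π ∧ IsBirational π ∧ IsIntegral Z ∧
      (∀ z : Z, IsIntegrallyClosed (Z.presheaf.stalk z)) ∧
      ∀ z : Z, ∃ U : Z.Opens, z ∈ U ∧ ∃ (W : Scheme.{0}) (h : W ⟶ (U : Scheme.{0})),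
        IsIntegral W ∧ Scheme.IsRegular W ∧ IsFinite h ∧ UniversallyInjective h ∧
          Function.Surjective h.base :=
  tameResolution_of_dim_le_three hCP k X f hdim

/-! ## Calibration against the summit: resolution in characteristic `p` implies the stub -/

/-- **Resolution in characteristic `p` implies `TameResolution_p`.** If every reduced separated
scheme of finite type over every field of characteristic `p` has a resolution of singularities
(`ResolutionInChar p`), then every integral separated `X` of finite type over a field of
characteristic `p` has a tame resolution. [folklore] -/
theorem tameResolution_of_resolutionInChar {p : ℕ} (h : ResolutionInChar.{0} p) (k : Type)
    [Field k] [CharP k p] (X : Scheme.{0}) (f : X ⟶ Spec (.of k)) [IsSeparated f]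
    [LocallyOfFiniteType f] [QuasiCompact f] [IsIntegral X] :
    ∃ (Z : Scheme.{0}) (π : Z ⟶ X), IsProper π ∧ IsBirational π ∧ IsIntegral Z ∧
      (∀ z : Z, IsIntegrallyClosed (Z.presheaf.stalk z)) ∧
      ∀ z : Z, ∃ U : Z.Opens, z ∈ U ∧ ∃ (W : Scheme.{0}) (h : W ⟶ (U : Scheme.{0})),
        IsIntegral W ∧ Scheme.IsRegular W ∧ IsFinite h ∧ UniversallyInjective h ∧
          Function.Surjective h.base :=
  exists_tameResolution_of_hasResolution X (h k X f ‹_› ‹_› ‹_› inferInstance)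

/-- **The summit statement implies the stub, in its registered form.** Under
`ResolutionOfSingularities` (resolution in every prime characteristic, the summit conjunct),
`stub_tameResolution` holds verbatim: for every prime `p`, perfect field `k` of characteristic
`p` and integral separated `X` of finite type over `k`, a tame resolution exists. So the stub
is a CONSEQUENCE of the summit (it is a partial-resolution statement, not a strengthening).
[folklore] -/
theorem stubTameResolution_of_resolutionOfSingularities (h : ResolutionOfSingularities) (p : ℕ)
    (hp : p.Prime) (k : Type) [Field k] [CharP k p] [PerfectField k] (X : Scheme.{0})
    (f : X ⟶ Spec (.of k)) [IsSeparated f] [LocallyOfFiniteType f] [QuasiCompact f]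
    [IsIntegral X] :
    ∃ (Z : Scheme.{0}) (π : Z ⟶ X), IsProper π ∧ IsBirational π ∧ IsIntegral Z ∧
      (∀ z : Z, IsIntegrallyClosed (Z.presheaf.stalk z)) ∧
      ∀ z : Z, ∃ U : Z.Opens, z ∈ U ∧ ∃ (W : Scheme.{0}) (h : W ⟶ (U : Scheme.{0})),
        IsIntegral W ∧ Scheme.IsRegular W ∧ IsFinite h ∧ UniversallyInjective h ∧
          Function.Surjective h.base :=
  tameResolution_of_resolutionInChar (h p hp) k X f

/-! ## The terminal class: normal LRR schemes are their own tame resolutions -/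

/-- **The LRR class is terminal.** A normal integral scheme all of whose points are locally
radicially regular is its own tame resolution: `π := 𝟙 X` is proper and birational (an
isomorphism over the dense open `⊤`). In particular `stub_tameResolution` holds for every such
`X` (e.g. every normal radicially regular variety, such as the normal purely inseparable
hypersurfaces `z^{p^e} = F` dominated by a regular Frobenius sandwich). [folklore] -/
theorem tameResolution_of_normal_of_locallyRadiciallyRegular (X : Scheme.{0}) [IsIntegral X]
    (hN : ∀ x : X, IsIntegrallyClosed (X.presheaf.stalk x))
    (hL : ∀ x : X, ∃ U : X.Opens, x ∈ U ∧ ∃ (W : Scheme.{0}) (h : W ⟶ (U : Scheme.{0})),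
      IsIntegral W ∧ Scheme.IsRegular W ∧ IsFinite h ∧ UniversallyInjective h ∧
        Function.Surjective h.base) :
    ∃ (Z : Scheme.{0}) (π : Z ⟶ X), IsProper π ∧ IsBirational π ∧ IsIntegral Z ∧
      (∀ z : Z, IsIntegrallyClosed (Z.presheaf.stalk z)) ∧
      ∀ z : Z, ∃ U : Z.Opens, z ∈ U ∧ ∃ (W : Scheme.{0}) (h : W ⟶ (U : Scheme.{0})),
        IsIntegral W ∧ Scheme.IsRegular W ∧ IsFinite h ∧ UniversallyInjective h ∧
          Function.Surjective h.base :=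
  ⟨X, 𝟙 X, inferInstance, ⟨⊤, by simp, by simp, inferInstance⟩, ‹_›, hN, hL⟩

/-! ## The registered stub, by name -/

/-- **A resolution is a tame resolution** — the REGISTERED stub
`stub_tameResolution_of_hasResolution` of the skeleton `radicially-regular-endgame`
(`Cruxes/Pialt/Lines/SketchIdeator2.lean`), verbatim, closed by name: it is
`exists_tameResolution_of_hasResolution` above (if the integral `X` admits a resolution of
singularities, that resolution is proper, birational, with integral normal source all of whose
points are locally radicially regular). [folklore] -/
theorem stub_tameResolution_of_hasResolution (X : Scheme.{0}) [IsIntegral X]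
    (hres : Scheme.HasResolution X) :
    ∃ (Z : Scheme.{0}) (π : Z ⟶ X), IsProper π ∧ IsBirational π ∧ IsIntegral Z ∧
      (∀ z : Z, IsIntegrallyClosed (Z.presheaf.stalk z)) ∧
      ∀ z : Z, ∃ U : Z.Opens, z ∈ U ∧ ∃ (W : Scheme.{0}) (h : W ⟶ (U : Scheme.{0})),
        IsIntegral W ∧ Scheme.IsRegular W ∧ IsFinite h ∧ UniversallyInjective h ∧
          Function.Surjective h.base :=
  exists_tameResolution_of_hasResolution X hres

end Summit.ResolutionOfSingularities.ResolutionOfSingularities.Theorems.Pialt.RadiciallyRegular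

end
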